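import Literature.NumberTheory.Sieve.CFSemigroupConvergents
import HarnessLib

/-!
# The pressure function of the continued-fractions semigroup `Γ_A`

Support file (all results proved) for the named fact
`Literature.NumberTheory.Sieve.MageeOhWinter2019_uniformCounting` (`CFSemigroupCounting.lean`):
the elementary thermodynamic formalism of [MageeOhWinter2019, §2.2] for the continued fractions
semigroup, in the concrete form of partition functions of continuants.

For a finite word `w = (a₁, …, aₙ)` of positive integers let `q(w)` be its continuant (the
denominator of `[0; a₁, …, aₙ]`, the `(1,1)` entry of the word matrix `g_{a₁} ⋯ g_{aₙ}`). For a
finite alphabet `A ⊆ ℕ_{≥1}` the **partition function** is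
`Z_n(s) = Σ_{w ∈ Aⁿ} q(w)^{-2s}` and the **pressure** is `P_A(s) = lim_n (1/n) log Z_n(s)` — the
pressure `P(-sτ)` of the distortion function `τ = log |T'|` of [MageeOhWinter2019, §2.1–2.2] for
the Gauss-type map `T` of `Γ_A`, since `|(g_w)'| ≍ q(w)^{-2}` on the unit interval (bounded
distortion). We prove:

* `cfQ_mul_le_cfQ_append`, `cfQ_append_le`: quasi-multiplicativity of continuants,
  `q(u) q(v) ≤ q(uv) ≤ 2 q(u) q(v)`;
* `cfPartition_add_le`, `le_cfPartition_add`: `4^{-s} Z_m Z_n ≤ Z_{m+n} ≤ Z_m Z_n` (`s ≥ 0`);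
* `cfPressure`, `tendsto_cfPressure`: the limit `P_A(s) = lim (1/n) log Z_n(s)` exists (Fekete);
  `exp_mul_cfPressure_le`, `cfPartition_le_exp`: `e^{nP(s)} ≤ Z_n(s) ≤ 4^s e^{nP(s)}`;
* `cfPressure_zero`: `P_A(0) = log #A`; `cfPressure_le_sub`, `sub_le_cfPressure`:
  `-(2 log (B+1)) (t-s) ≤ P_A(t) - P_A(s) ≤ -(log 2)(t-s)` for `0 ≤ s ≤ t` (`A ⊆ [1, B]`): `P_A` is
  Lipschitz and strictly decreasing ("`P(-sτ)` is strictly decreasing in a real parameter `s`");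
* `cfPressureZero`, `cfPressure_cfPressureZero`, `cfPressureZero_pos`, `cfPressureZero_unique`:
  for `#A ≥ 2` it "has a unique positive zero" `s_A` [MageeOhWinter2019, §2.2], and
  `1 ≤ Z_n(s_A) ≤ 4^{s_A}` for all `n` (`one_le_cfPartition_cfPressureZero`,
  `cfPartition_cfPressureZero_le`).

The identification `s_A = δ_A = dim_H E_A` (Bowen's formula, [MageeOhWinter2019, §2.2]:
"`s₀ = δ`, where `δ` is the Hausdorff dimension of `K`") is the object of a sequel file.

## References

* M. Magee, H. Oh, D. Winter, *Uniform congruence counting for Schottky semigroups in SL₂(𝐙)*,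
  J. reine angew. Math. 753 (2019) 89–135, §2.1 (eq. (2.1), Prop. 5), §2.2. [MageeOhWinter2019]
* D. Hensley, *Continued fraction Cantor sets, Hausdorff dimension, and functional analysis*,
  J. Number Theory 40 (1992) 336–358 (the partition functions `Σ_{w ∈ Aⁿ} q(w)^{-2s}`).
-/

noncomputable section

open Filter Set
open scoped Topology

namespace Literature.NumberTheory.Sieve

/-! ### Finite words: digit sequences, word matrices, continuants -/

variable {m n : ℕ}

/-- The digit sequence of a finite word `w : Fin n → ℕ`, extended beyond place `n` by the
(irrelevant) digit `1`. [folklore] -/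
def cfExt {n : ℕ} (w : Fin n → ℕ) : ℕ → ℕ := fun i => if h : i < n then w ⟨i, h⟩ else 1

/-- Digits below the length are the word's letters. [folklore] -/
theorem cfExt_of_lt (w : Fin n → ℕ) {i : ℕ} (h : i < n) : cfExt w i = w ⟨i, h⟩ := dif_pos h

/-- Digits below the length are the word's letters (`Fin` form). [folklore] -/
@[simp] theorem cfExt_apply_fin (w : Fin n → ℕ) (i : Fin n) : cfExt w i = w i := by
  rw [cfExt_of_lt w i.2]

/-- Digits beyond the length are `1`. [folklore] -/
theorem cfExt_of_le (w : Fin n → ℕ) {i : ℕ} (h : n ≤ i) : cfExt w i = 1 := dif_neg (not_lt.2 h)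

/-- All extended digits are `≥ 1` if the word's digits are. [folklore] -/
theorem one_le_cfExt {w : Fin n → ℕ} (hw : ∀ i, 1 ≤ w i) (i : ℕ) : 1 ≤ cfExt w i := by
  unfold cfExt
  split_ifs with h
  · exact hw _
  · exact le_rfl

/-- All extended digits are `≤ B` (`B ≥ 1`) if the word's digits are. [folklore] -/
theorem cfExt_le {w : Fin n → ℕ} {B : ℕ} (hB : 1 ≤ B) (hw : ∀ i, w i ≤ B) (i : ℕ) :
    cfExt w i ≤ B := by
  unfold cfExt
  split_ifs with h
  · exact hw _
  · exact hB

/-- The word matrix `M_w = g_{w 0} ⋯ g_{w (n-1)}` of a finite word. [folklore] -/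
def cfMat (w : Fin n → ℕ) : Matrix (Fin 2) (Fin 2) ℤ := cfWord (cfExt w) n

/-- The continuant `q(w) = (M_w)₁₁` of a finite word (the denominator of `[0; w]`). [folklore] -/
def cfQ (w : Fin n → ℕ) : ℤ := cfDen (cfExt w) n

/-- `q(w) = (M_w)₁₁`. [folklore] -/
theorem cfQ_eq (w : Fin n → ℕ) : cfQ w = cfMat w 1 1 := rfl

/-- The empty word has continuant `1`. [folklore] -/
@[simp] theorem cfQ_fin_zero (w : Fin 0 → ℕ) : cfQ w = 1 := by simp [cfQ]

/-- The digits of `uv` below `|u|` are those of `u`. [folklore] -/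
theorem cfExt_append_left (u : Fin m → ℕ) (v : Fin n → ℕ) {i : ℕ} (hi : i < m) :
    cfExt (Fin.append u v) i = cfExt u i := by
  rw [cfExt_of_lt _ (Nat.lt_add_right n hi), cfExt_of_lt _ hi]
  exact Fin.append_left u v ⟨i, hi⟩

/-- The digits of `uv` from place `|u|` on are those of `v`. [folklore] -/
theorem cfExt_append_right (u : Fin m → ℕ) (v : Fin n → ℕ) {i : ℕ} (hi : i < n) :
    cfExt (Fin.append u v) (i + m) = cfExt v i := by
  rw [cfExt_of_lt _ (by omega), cfExt_of_lt _ hi]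
  have e : (⟨i + m, by omega⟩ : Fin (m + n)) = Fin.natAdd m ⟨i, hi⟩ := Fin.ext (Nat.add_comm i m)
  rw [e, Fin.append_right]

/-- `M_{uv} = M_u M_v`. [folklore] -/
theorem cfMat_append (u : Fin m → ℕ) (v : Fin n → ℕ) :
    cfMat (Fin.append u v) = cfMat u * cfMat v := by
  unfold cfMat
  have h := cfWord_add (cfExt (Fin.append u v)) m n
  rw [Nat.add_comm n m] at h
  rw [h, cfWord_congr (fun i hi => cfExt_append_left u v hi),
    cfWord_congr (d := fun i => cfExt (Fin.append u v) (i + m))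
      (fun i hi => cfExt_append_right u v hi)]

/-- `q(uv) = (M_u)₁₀ p(v) + q(u) q(v)`. [folklore] -/
theorem cfQ_append (u : Fin m → ℕ) (v : Fin n → ℕ) :
    cfQ (Fin.append u v) = cfMat u 1 0 * cfNum (cfExt v) n + cfQ u * cfQ v := by
  rw [cfQ_eq, cfMat_append, Matrix.mul_apply, Fin.sum_univ_two]
  rfl

/-- `q(w) ≥ 1`. [folklore] -/
theorem one_le_cfQ {w : Fin n → ℕ} (hw : ∀ i, 1 ≤ w i) : 1 ≤ cfQ w :=
  one_le_cfDen (one_le_cfExt hw) n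

/-- **Quasi-multiplicativity of continuants, lower:** `q(u) q(v) ≤ q(uv)`. [folklore] -/
theorem cfQ_mul_le_cfQ_append {u : Fin m → ℕ} {v : Fin n → ℕ} (hv : ∀ i, 1 ≤ v i) :
    cfQ u * cfQ v ≤ cfQ (Fin.append u v) := by
  rw [cfQ_append]
  have h1 : 0 ≤ cfMat u 1 0 := cfWord_nonneg _ _ 1 0
  have h2 : 0 ≤ cfNum (cfExt v) n := cfNum_nonneg _ _
  have _ := hv
  nlinarith

/-- **Quasi-multiplicativity of continuants, upper:** `q(uv) ≤ 2 q(u) q(v)`. [folklore] -/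
theorem cfQ_append_le {u : Fin m → ℕ} {v : Fin n → ℕ} (hu : ∀ i, 1 ≤ u i) (hv : ∀ i, 1 ≤ v i) :
    cfQ (Fin.append u v) ≤ 2 * (cfQ u * cfQ v) := by
  rw [cfQ_append]
  have h1 : cfMat u 1 0 ≤ cfQ u := cfWord_10_le_cfDen (one_le_cfExt hu) m
  have h2 : cfNum (cfExt v) n ≤ cfQ v := cfNum_le_cfDen (one_le_cfExt hv) n
  have h3 : 0 ≤ cfMat u 1 0 := cfWord_nonneg _ _ 1 0
  have h4 : 0 ≤ cfNum (cfExt v) n := cfNum_nonneg _ _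
  have h5 : cfMat u 1 0 * cfNum (cfExt v) n ≤ cfQ u * cfQ v :=
    mul_le_mul h1 h2 h4 (h3.trans h1)
  linarith

/-- `q(w) ≤ (B+1)^n` for digits in `[1, B]`. [folklore] -/
theorem cfQ_le_pow {w : Fin n → ℕ} (hw : ∀ i, 1 ≤ w i) {B : ℕ} (hB : ∀ i, w i ≤ B) :
    cfQ w ≤ ((B : ℤ) + 1) ^ n := by
  rcases n with _ | k
  · simp
  · exact cfDen_le_pow (one_le_cfExt hw) (cfExt_le ((hw 0).trans (hB 0)) hB) (k + 1)

/-- `2^{n-1} ≤ q(w)²`: continuants grow geometrically. [folklore] -/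
theorem pow_le_cfQ_sq {w : Fin n → ℕ} (hw : ∀ i, 1 ≤ w i) : (2 : ℤ) ^ (n - 1) ≤ cfQ w ^ 2 := by
  rcases n with _ | k
  · simp
  · have hd := one_le_cfExt hw
    have h1 := pow_le_cfDen_mul hd k
    have h2 := cfDen_le_succ hd k
    have h3 : (0 : ℤ) ≤ cfDen (cfExt w) (k + 1) := zero_le_one.trans (one_le_cfDen hd _)
    rw [Nat.add_sub_cancel, cfQ, sq]
    nlinarith [mul_le_mul_of_nonneg_right h2 h3]

/-! ### The partition functions `Z_n(s)` -/

variable (A : Finset ℕ)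

/-- The **partition function** `Z_n(s) = Σ_{w ∈ Aⁿ} q(w)^{-2s}` of the alphabet `A` (written with
`(q(w)²)^{-s}`). [cite: MageeOhWinter2019, §2.2] -/
def cfPartition (n : ℕ) (s : ℝ) : ℝ :=
  ∑ w : Fin n → A, (((cfQ fun i => (w i : ℕ)) : ℝ) ^ 2) ^ (-s)

variable {A}

/-- Coercion `A → ℕ` commutes with concatenation of words. [folklore] -/
theorem coe_append (u : Fin m → A) (v : Fin n → A) :
    (fun i => ((Fin.append u v i : A) : ℕ)) = Fin.append (fun i => (u i : ℕ)) fun i => (v i : ℕ) := by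
  funext i
  induction i using Fin.addCases <;> simp

/-- Splitting `Z_{m+n}` over concatenations `w = uv`. [folklore] -/
theorem cfPartition_add (m n : ℕ) (s : ℝ) :
    cfPartition A (m + n) s = ∑ u : Fin m → A, ∑ v : Fin n → A,
      (((cfQ (Fin.append (fun i => (u i : ℕ)) fun i => (v i : ℕ)) : ℝ) ^ 2) ^ (-s)) := by
  rw [cfPartition, ← (Fin.appendEquiv m n).sum_comp, Fintype.sum_prod_type]
  refine Finset.sum_congr rfl fun u _ => Finset.sum_congr rfl fun v _ => ?_
  simp only [Fin.appendEquiv_apply]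
  rw [coe_append]

/-- `Z_0(s) = 1`. [folklore] -/
@[simp] theorem cfPartition_zero_left (s : ℝ) : cfPartition A 0 s = 1 := by
  simp [cfPartition]

/-- `Z_n(0) = #Aⁿ`. [folklore] -/
theorem cfPartition_zero_right (n : ℕ) : cfPartition A n 0 = (A.card : ℝ) ^ n := by
  simp [cfPartition]

/-- An auxiliary Archimedean step: if `n c ≤ K` for all `n ∈ ℕ` then `c ≤ 0`. [folklore] -/
theorem nonpos_of_nat_mul_le {c K : ℝ} (h : ∀ n : ℕ, n * c ≤ K) : c ≤ 0 := by
  by_contra hc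
  push Not at hc
  obtain ⟨n, hn⟩ := exists_nat_gt (K / c)
  have := h n
  rw [div_lt_iff₀ hc] at hn
  linarith

section basic

variable (hA : ∀ a ∈ A, 1 ≤ a)
include hA

/-- Letters of a word over `A ⊆ ℕ_{≥1}` are `≥ 1`. [folklore] -/
theorem one_le_coe_digit (w : Fin n → A) (i : Fin n) : 1 ≤ ((w i : A) : ℕ) := hA _ (w i).2

/-- `1 ≤ q(w)` in `ℝ` for `w ∈ Aⁿ`. [folklore] -/
theorem one_le_cfQ_cast (w : Fin n → A) : (1 : ℝ) ≤ (cfQ fun i => (w i : ℕ) : ℝ) := by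
  exact_mod_cast one_le_cfQ (one_le_coe_digit hA w)

/-- Each term of `Z_n(s)` is positive. [folklore] -/
theorem cfPartition_term_pos (w : Fin n → A) (s : ℝ) :
    0 < (((cfQ fun i => (w i : ℕ)) : ℝ) ^ 2) ^ (-s) :=
  Real.rpow_pos_of_pos (by nlinarith [one_le_cfQ_cast hA w]) _

/-- Each term of `Z_n(s)` is `≤ 1` for `s ≥ 0`. [folklore] -/
theorem cfPartition_term_le_one (w : Fin n → A) {s : ℝ} (hs : 0 ≤ s) :
    (((cfQ fun i => (w i : ℕ)) : ℝ) ^ 2) ^ (-s) ≤ 1 :=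
  Real.rpow_le_one_of_one_le_of_nonpos (by nlinarith [one_le_cfQ_cast hA w]) (by linarith)

/-- `Z_n(s) > 0` (`A ≠ ∅`). [folklore] -/
theorem cfPartition_pos (hne : A.Nonempty) (n : ℕ) (s : ℝ) : 0 < cfPartition A n s := by
  haveI : Nonempty A := hne.to_subtype
  exact Finset.sum_pos (fun w _ => cfPartition_term_pos hA w s) Finset.univ_nonempty

/-- `Z_n(s) ≤ #Aⁿ` for `s ≥ 0`. [folklore] -/
theorem cfPartition_le_card_pow (n : ℕ) {s : ℝ} (hs : 0 ≤ s) :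
    cfPartition A n s ≤ (A.card : ℝ) ^ n := by
  calc cfPartition A n s ≤ ∑ _w : Fin n → A, (1 : ℝ) :=
        Finset.sum_le_sum fun w _ => cfPartition_term_le_one hA w hs
    _ = (A.card : ℝ) ^ n := by simp

/-- `Z_n(s) ≥ ((B+1)^{2n})^{-s}` for `s ≥ 0`, `A ⊆ [1, B]` nonempty. [folklore] -/
theorem pow_le_cfPartition (hne : A.Nonempty) {B : ℕ} (hB : ∀ a ∈ A, a ≤ B) (n : ℕ) {s : ℝ}
    (hs : 0 ≤ s) : ((((B : ℝ) + 1) ^ n) ^ 2) ^ (-s) ≤ cfPartition A n s := by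
  obtain ⟨a, ha⟩ := hne
  set w₀ : Fin n → A := fun _ => ⟨a, ha⟩
  have hterm : ((((B : ℝ) + 1) ^ n) ^ 2) ^ (-s) ≤ (((cfQ fun i => (w₀ i : ℕ)) : ℝ) ^ 2) ^ (-s) := by
    have hq1 := one_le_cfQ_cast hA w₀
    have hqB : (cfQ (fun i => (w₀ i : ℕ)) : ℝ) ≤ ((B : ℝ) + 1) ^ n := by
      have := cfQ_le_pow (one_le_coe_digit hA w₀) (B := B) fun i => hB _ (w₀ i).2
      exact_mod_cast this
    exact Real.rpow_le_rpow_of_nonpos (pow_pos (by linarith) 2) (pow_le_pow_left₀ (by linarith) hqB 2)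
      (by linarith)
  exact hterm.trans (Finset.single_le_sum (fun w _ => (cfPartition_term_pos hA w s).le)
    (Finset.mem_univ w₀))

/-- **Submultiplicativity** `Z_{m+n}(s) ≤ Z_m(s) Z_n(s)` (`s ≥ 0`), from `q(uv) ≥ q(u) q(v)`.
[folklore] -/
theorem cfPartition_add_le {s : ℝ} (hs : 0 ≤ s) (m n : ℕ) :
    cfPartition A (m + n) s ≤ cfPartition A m s * cfPartition A n s := by
  rw [cfPartition_add, cfPartition, cfPartition, Finset.sum_mul_sum]
  refine Finset.sum_le_sum fun u _ => Finset.sum_le_sum fun v _ => ?_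
  have hu1 := one_le_cfQ_cast hA u
  have hv1 := one_le_cfQ_cast hA v
  rw [← Real.mul_rpow (by positivity) (by positivity), ← mul_pow]
  refine Real.rpow_le_rpow_of_nonpos (by positivity) ?_ (by linarith)
  have h := cfQ_mul_le_cfQ_append (u := fun i => (u i : ℕ)) (one_le_coe_digit hA v)
  have h' : (cfQ (fun i => (u i : ℕ)) : ℝ) * cfQ (fun i => (v i : ℕ)) ≤
      cfQ (Fin.append (fun i => (u i : ℕ)) fun i => (v i : ℕ)) := by exact_mod_cast h
  exact pow_le_pow_left₀ (by positivity) h' 2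

/-- **Supermultiplicativity** `4^{-s} Z_m(s) Z_n(s) ≤ Z_{m+n}(s)` (`s ≥ 0`), from
`q(uv) ≤ 2 q(u) q(v)`. [folklore] -/
theorem le_cfPartition_add {s : ℝ} (hs : 0 ≤ s) (m n : ℕ) :
    (4 : ℝ) ^ (-s) * (cfPartition A m s * cfPartition A n s) ≤ cfPartition A (m + n) s := by
  rw [cfPartition_add, cfPartition, cfPartition, Finset.sum_mul_sum, Finset.mul_sum]
  refine Finset.sum_le_sum fun u _ => ?_
  rw [Finset.mul_sum]
  refine Finset.sum_le_sum fun v _ => ?_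
  have hu1 := one_le_cfQ_cast hA u
  have hv1 := one_le_cfQ_cast hA v
  rw [← Real.mul_rpow (by positivity) (by positivity), ← Real.mul_rpow (by positivity)
    (by positivity)]
  have h := cfQ_append_le (one_le_coe_digit hA u) (one_le_coe_digit hA v)
  have h' : (cfQ (Fin.append (fun i => (u i : ℕ)) fun i => (v i : ℕ)) : ℝ) ≤
      2 * (cfQ (fun i => (u i : ℕ)) * cfQ (fun i => (v i : ℕ))) := by exact_mod_cast h
  have h0 : (1 : ℝ) ≤ cfQ (Fin.append (fun i => (u i : ℕ)) fun i => (v i : ℕ)) := by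
    have := one_le_cfQ_cast hA (Fin.append u v)
    rwa [coe_append] at this
  refine Real.rpow_le_rpow_of_nonpos (by positivity) ?_ (by linarith)
  nlinarith

/-- Comparing exponents, upper: `Z_n(t) ≤ (2^{n-1})^{-(t-s)} Z_n(s)` for `s ≤ t`
(`q(w)² ≥ 2^{n-1}`). [folklore] -/
theorem cfPartition_le_of_le {s t : ℝ} (hst : s ≤ t) (n : ℕ) :
    cfPartition A n t ≤ ((2 : ℝ) ^ (n - 1)) ^ (-(t - s)) * cfPartition A n s := by
  rw [cfPartition, cfPartition, Finset.mul_sum]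
  refine Finset.sum_le_sum fun w _ => ?_
  have hq1 := one_le_cfQ_cast hA w
  have hV : (0 : ℝ) < (cfQ (fun i => (w i : ℕ)) : ℝ) ^ 2 := by positivity
  have hgrow : (2 : ℝ) ^ (n - 1) ≤ (cfQ (fun i => (w i : ℕ)) : ℝ) ^ 2 := by
    exact_mod_cast pow_le_cfQ_sq (one_le_coe_digit hA w)
  have hsplit : -t = -(t - s) + -s := by ring
  rw [hsplit, Real.rpow_add hV]
  exact mul_le_mul_of_nonneg_right
    (Real.rpow_le_rpow_of_nonpos (by positivity) hgrow (by linarith)) (Real.rpow_nonneg hV.le _)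

/-- Comparing exponents, lower: `((B+1)^{2n})^{-(t-s)} Z_n(s) ≤ Z_n(t)` for `s ≤ t`, `A ⊆ [1,B]`
(`q(w) ≤ (B+1)^n`). [folklore] -/
theorem le_cfPartition_of_le {B : ℕ} (hB : ∀ a ∈ A, a ≤ B) {s t : ℝ} (hst : s ≤ t) (n : ℕ) :
    ((((B : ℝ) + 1) ^ n) ^ 2) ^ (-(t - s)) * cfPartition A n s ≤ cfPartition A n t := by
  rw [cfPartition, cfPartition, Finset.mul_sum]
  refine Finset.sum_le_sum fun w _ => ?_
  have hq1 := one_le_cfQ_cast hA w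
  have hV : (0 : ℝ) < (cfQ (fun i => (w i : ℕ)) : ℝ) ^ 2 := by positivity
  have hqB : (cfQ (fun i => (w i : ℕ)) : ℝ) ≤ ((B : ℝ) + 1) ^ n := by
    have := cfQ_le_pow (one_le_coe_digit hA w) (B := B) fun i => hB _ (w i).2
    exact_mod_cast this
  have hsplit : -t = -(t - s) + -s := by ring
  rw [hsplit, Real.rpow_add hV]
  exact mul_le_mul_of_nonneg_right
    (Real.rpow_le_rpow_of_nonpos hV (pow_le_pow_left₀ (by linarith) hqB 2) (by linarith))
    (Real.rpow_nonneg hV.le _)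

end basic

/-! ### The pressure function -/

variable (A) in
/-- The **pressure function** `P_A(s) = lim_n (1/n) log Z_n(s)` (`= inf_{n ≥ 1}` by
subadditivity; the pressure `P(-sτ)` of [MageeOhWinter2019, §2.2] for `Γ_A`).
[cite: MageeOhWinter2019, §2.2] -/
def cfPressure (s : ℝ) : ℝ :=
  sInf ((fun n : ℕ => Real.log (cfPartition A n s) / n) '' Ici 1)

section pressure

variable (hA : ∀ a ∈ A, 1 ≤ a)
include hA

/-- `n ↦ log Z_n(s)` is subadditive (`s ≥ 0`). [folklore] -/
theorem subadditive_log_cfPartition (hne : A.Nonempty) {s : ℝ} (hs : 0 ≤ s) :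
    Subadditive fun n => Real.log (cfPartition A n s) := by
  intro m n
  have hm := cfPartition_pos hA hne m s
  have hn := cfPartition_pos hA hne n s
  rw [← Real.log_mul hm.ne' hn.ne']
  exact Real.log_le_log (cfPartition_pos hA hne _ s) (cfPartition_add_le hA hs m n)

/-- `(1/n) log Z_n(s) ≤ log #A` (`s ≥ 0`). [folklore] -/
theorem log_cfPartition_div_le (hne : A.Nonempty) {s : ℝ} (hs : 0 ≤ s) (n : ℕ) :
    Real.log (cfPartition A n s) / n ≤ Real.log A.card := by
  rcases Nat.eq_zero_or_pos n with rfl | hn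
  · simp only [Nat.cast_zero, div_zero]
    exact Real.log_nonneg (by exact_mod_cast hne.card_pos)
  · rw [div_le_iff₀ (by exact_mod_cast hn)]
    have h1 : Real.log (cfPartition A n s) ≤ Real.log ((A.card : ℝ) ^ n) :=
      Real.log_le_log (cfPartition_pos hA hne n s) (cfPartition_le_card_pow hA n hs)
    rw [Real.log_pow] at h1
    linarith

/-- `(1/n) log Z_n(s) ≥ -2s log (B+1)` (`s ≥ 0`, `A ⊆ [1, B]`). [folklore] -/
theorem le_log_cfPartition_div (hne : A.Nonempty) {B : ℕ} (hB : ∀ a ∈ A, a ≤ B) {s : ℝ} (hs : 0 ≤ s) (n : ℕ) :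
    -(2 * s * Real.log ((B : ℝ) + 1)) ≤ Real.log (cfPartition A n s) / n := by
  have hlogB : 0 ≤ Real.log ((B : ℝ) + 1) := Real.log_nonneg (by linarith [(Nat.cast_nonneg B : (0 : ℝ) ≤ B)])
  rcases Nat.eq_zero_or_pos n with rfl | hn
  · simp only [Nat.cast_zero, div_zero]
    nlinarith
  · rw [le_div_iff₀ (by exact_mod_cast hn)]
    have h1 := Real.log_le_log (Real.rpow_pos_of_pos (by positivity) _)
      (pow_le_cfPartition hA hne hB n hs)
    rw [Real.log_rpow (by positivity), Real.log_pow, Real.log_pow] at h1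
    calc -(2 * s * Real.log ((B : ℝ) + 1)) * n
        = -s * ((2 : ℕ) * ((n : ℝ) * Real.log ((B : ℝ) + 1))) := by push_cast; ring
      _ ≤ Real.log (cfPartition A n s) := h1

/-- `(1/n) log Z_n(s)` is bounded below (`s ≥ 0`). [folklore] -/
theorem bddBelow_log_cfPartition_div (hne : A.Nonempty) {s : ℝ} (hs : 0 ≤ s) :
    BddBelow (range fun n : ℕ => Real.log (cfPartition A n s) / n) := by
  obtain ⟨B, hB⟩ : ∃ B, ∀ a ∈ A, a ≤ B := ⟨A.sup id, fun a ha => Finset.le_sup (f := id) ha⟩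
  exact ⟨_, by rintro _ ⟨n, rfl⟩; exact le_log_cfPartition_div hA hne hB hs n⟩

/-- `P_A(s)` is the Fekete limit `Subadditive.lim` of `log Z_n(s)`. [folklore] -/
theorem cfPressure_eq_lim (hne : A.Nonempty) {s : ℝ} (hs : 0 ≤ s) :
    cfPressure A s = (subadditive_log_cfPartition hA hne hs).lim := by
  rw [Subadditive.lim, cfPressure]

/-- **Fekete:** `(1/n) log Z_n(s) → P_A(s)` (`s ≥ 0`). [cite: MageeOhWinter2019, §2.2] -/
theorem tendsto_cfPressure (hne : A.Nonempty) {s : ℝ} (hs : 0 ≤ s) :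
    Tendsto (fun n : ℕ => Real.log (cfPartition A n s) / n) atTop (𝓝 (cfPressure A s)) := by
  rw [cfPressure_eq_lim hA hne hs]
  exact (subadditive_log_cfPartition hA hne hs).tendsto_lim (bddBelow_log_cfPartition_div hA hne hs)

/-- `P_A(s) ≤ (1/n) log Z_n(s)` for `n ≥ 1` (`s ≥ 0`). [folklore] -/
theorem cfPressure_le_log_div (hne : A.Nonempty) {s : ℝ} (hs : 0 ≤ s) {n : ℕ} (hn : n ≠ 0) :
    cfPressure A s ≤ Real.log (cfPartition A n s) / n := by
  rw [cfPressure_eq_lim hA hne hs]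
  exact (subadditive_log_cfPartition hA hne hs).lim_le_div (bddBelow_log_cfPartition_div hA hne hs)
    hn

/-- **Lower Gibbs bound** `e^{n P_A(s)} ≤ Z_n(s)` (`s ≥ 0`). [folklore] -/
theorem exp_mul_cfPressure_le (hne : A.Nonempty) {s : ℝ} (hs : 0 ≤ s) (n : ℕ) :
    Real.exp (n * cfPressure A s) ≤ cfPartition A n s := by
  rcases Nat.eq_zero_or_pos n with rfl | hn
  · simp
  · have h := cfPressure_le_log_div hA hne hs hn.ne'
    rw [le_div_iff₀ (by exact_mod_cast hn)] at h
    calc Real.exp (n * cfPressure A s) ≤ Real.exp (Real.log (cfPartition A n s)) :=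
          Real.exp_le_exp.2 (by linarith)
      _ = cfPartition A n s := Real.exp_log (cfPartition_pos hA hne n s)

/-- **Upper Gibbs bound** `Z_n(s) ≤ 4^s e^{n P_A(s)}` (`s ≥ 0`), from supermultiplicativity
(Fekete for the subadditive sequence `s log 4 - log Z_n(s)`). [folklore] -/
theorem cfPartition_le_exp (hne : A.Nonempty) {s : ℝ} (hs : 0 ≤ s) (n : ℕ) :
    cfPartition A n s ≤ (4 : ℝ) ^ s * Real.exp (n * cfPressure A s) := by
  set u : ℕ → ℝ := fun n => Real.log (cfPartition A n s) with hu
  set v : ℕ → ℝ := fun n => s * Real.log 4 - u n with hv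
  have hvsub : Subadditive v := by
    intro m k
    simp only [hv, hu]
    have hm := cfPartition_pos hA hne m s
    have hk := cfPartition_pos hA hne k s
    have hle := le_cfPartition_add hA hs m k
    have hlog := Real.log_le_log (by positivity) hle
    rw [Real.log_mul (by positivity) (by positivity), Real.log_mul hm.ne' hk.ne',
      Real.log_rpow (by norm_num)] at hlog
    linarith
  have hlog4 : 0 ≤ s * Real.log 4 := mul_nonneg hs (Real.log_nonneg (by norm_num))
  have hvbdd : BddBelow (range fun n : ℕ => v n / n) := by
    refine ⟨-Real.log A.card, ?_⟩
    rintro _ ⟨k, rfl⟩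
    have h1 := log_cfPartition_div_le hA hne hs k
    simp only [hv, hu]
    rcases Nat.eq_zero_or_pos k with rfl | hk
    · simp only [Nat.cast_zero, div_zero, Left.neg_nonpos_iff]
      exact Real.log_nonneg (by exact_mod_cast hne.card_pos)
    · have hk' : (0 : ℝ) < k := by exact_mod_cast hk
      rw [sub_div]
      have : 0 ≤ s * Real.log 4 / k := div_nonneg hlog4 hk'.le
      linarith
  have hvlim : Tendsto (fun n : ℕ => v n / n) atTop (𝓝 hvsub.lim) := hvsub.tendsto_lim hvbdd
  have hvlim' : Tendsto (fun n : ℕ => v n / n) atTop (𝓝 (0 - cfPressure A s)) := by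
    have h1 : Tendsto (fun n : ℕ => s * Real.log 4 / (n : ℝ)) atTop (𝓝 0) :=
      tendsto_const_div_atTop_nhds_zero_nat _
    have h2 := tendsto_cfPressure hA hne hs
    refine (h1.sub h2).congr fun k => ?_
    simp only [hv, hu, sub_div]
  have hlimeq : hvsub.lim = -cfPressure A s := by
    have := tendsto_nhds_unique hvlim hvlim'
    rw [this, zero_sub]
  rcases Nat.eq_zero_or_pos n with rfl | hn
  · simp only [cfPartition_zero_left, Nat.cast_zero, zero_mul, Real.exp_zero, mul_one]
    exact Real.one_le_rpow (by norm_num) hs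
  · have h := hvsub.lim_le_div hvbdd hn.ne'
    rw [hlimeq, le_div_iff₀ (by exact_mod_cast hn)] at h
    simp only [hv, hu] at h
    have hZ := cfPartition_pos hA hne n s
    calc cfPartition A n s = Real.exp (Real.log (cfPartition A n s)) := (Real.exp_log hZ).symm
      _ ≤ Real.exp (s * Real.log 4 + n * cfPressure A s) := Real.exp_le_exp.2 (by linarith)
      _ = (4 : ℝ) ^ s * Real.exp (n * cfPressure A s) := by
          rw [Real.exp_add, Real.rpow_def_of_pos (by norm_num : (0 : ℝ) < 4), mul_comm (Real.log 4)]

/-- `P_A(0) = log #A`. [folklore] -/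
theorem cfPressure_zero (hne : A.Nonempty) : cfPressure A 0 = Real.log A.card := by
  have h := tendsto_cfPressure hA hne le_rfl
  have h' : Tendsto (fun n : ℕ => Real.log (cfPartition A n 0) / n) atTop (𝓝 (Real.log A.card)) := by
    refine (tendsto_const_nhds (x := Real.log (A.card : ℝ))).congr' ?_
    filter_upwards [eventually_ge_atTop 1] with n hn
    rw [cfPartition_zero_right, Real.log_pow, mul_div_cancel_left₀ _ (Nat.cast_ne_zero.2 (by omega))]
  exact tendsto_nhds_unique h h'

/-- **Strict decrease of the pressure, quantitatively:** `P_A(t) ≤ P_A(s) - (t - s) log 2` for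
`0 ≤ s ≤ t` ("`P(-sτ)` is strictly decreasing in a real parameter `s`"). [cite: MageeOhWinter2019, §2.2] -/
theorem cfPressure_le_sub (hne : A.Nonempty) {s t : ℝ} (hs : 0 ≤ s) (hst : s ≤ t) :
    cfPressure A t ≤ cfPressure A s - (t - s) * Real.log 2 := by
  have ht : 0 ≤ t := hs.trans hst
  -- `e^{nP(t)} ≤ Z_n(t) ≤ (2^{n-1})^{-(t-s)} Z_n(s) ≤ (2^{n-1})^{-(t-s)} 4^s e^{nP(s)}`
  have key : ∀ n : ℕ, (n : ℝ) * (cfPressure A t - cfPressure A s + (t - s) * Real.log 2) ≤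
      (t - s) * Real.log 2 + s * Real.log 4 := by
    intro n
    rcases Nat.eq_zero_or_pos n with rfl | hn
    · simp only [Nat.cast_zero, zero_mul]
      nlinarith [Real.log_nonneg (by norm_num : (1 : ℝ) ≤ 2), Real.log_nonneg (by norm_num : (1 : ℝ) ≤ 4)]
    have h1 := exp_mul_cfPressure_le hA hne ht n
    have h2 := cfPartition_le_of_le hA hst n
    have h3 := cfPartition_le_exp hA hne hs n
    have h20 : (0 : ℝ) < ((2 : ℝ) ^ (n - 1)) ^ (-(t - s)) := Real.rpow_pos_of_pos (by positivity) _
    have hchain : Real.exp (n * cfPressure A t) ≤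
        ((2 : ℝ) ^ (n - 1)) ^ (-(t - s)) * ((4 : ℝ) ^ s * Real.exp (n * cfPressure A s)) :=
      h1.trans (h2.trans (mul_le_mul_of_nonneg_left h3 h20.le))
    have hlog := Real.log_le_log (Real.exp_pos _) hchain
    rw [Real.log_exp, Real.log_mul h20.ne' (by positivity), Real.log_mul (by positivity)
      (Real.exp_pos _).ne', Real.log_exp, Real.log_rpow (by positivity), Real.log_rpow (by norm_num),
      Real.log_pow] at hlog
    have hn1 : ((n - 1 : ℕ) : ℝ) = n - 1 := by
      rw [Nat.cast_sub hn, Nat.cast_one]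
    rw [hn1] at hlog
    have e : (n : ℝ) * (cfPressure A t - cfPressure A s + (t - s) * Real.log 2) =
        n * cfPressure A t - n * cfPressure A s + (t - s) * ((n - 1) * Real.log 2) +
          (t - s) * Real.log 2 := by ring
    rw [e]
    linarith
  have := nonpos_of_nat_mul_le key
  linarith

/-- **Lipschitz lower bound for the pressure:** `P_A(s) - 2 (t - s) log (B+1) ≤ P_A(t)` for
`0 ≤ s ≤ t`, `A ⊆ [1, B]`. [folklore] -/
theorem sub_le_cfPressure (hne : A.Nonempty) {B : ℕ} (hB : ∀ a ∈ A, a ≤ B) {s t : ℝ} (hs : 0 ≤ s) (hst : s ≤ t) :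
    cfPressure A s - 2 * (t - s) * Real.log ((B : ℝ) + 1) ≤ cfPressure A t := by
  have ht : 0 ≤ t := hs.trans hst
  have hB1 : (1 : ℝ) ≤ (B : ℝ) + 1 := by linarith [(Nat.cast_nonneg B : (0 : ℝ) ≤ B)]
  -- `((B+1)^{2n})^{-(t-s)} e^{nP(s)} ≤ ((B+1)^{2n})^{-(t-s)} Z_n(s) ≤ Z_n(t) ≤ 4^t e^{nP(t)}`
  have key : ∀ n : ℕ, (n : ℝ) * (cfPressure A s - 2 * (t - s) * Real.log ((B : ℝ) + 1) -
      cfPressure A t) ≤ t * Real.log 4 := by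
    intro n
    rcases Nat.eq_zero_or_pos n with rfl | hn
    · simp only [Nat.cast_zero, zero_mul]
      nlinarith [Real.log_nonneg (by norm_num : (1 : ℝ) ≤ 4)]
    have h1 := exp_mul_cfPressure_le hA hne hs n
    have h2 := le_cfPartition_of_le hA hB hst n
    have h3 := cfPartition_le_exp hA hne ht n
    have hB0 : (0 : ℝ) < ((((B : ℝ) + 1) ^ n) ^ 2) ^ (-(t - s)) :=
      Real.rpow_pos_of_pos (by positivity) _
    have hchain : ((((B : ℝ) + 1) ^ n) ^ 2) ^ (-(t - s)) * Real.exp (n * cfPressure A s) ≤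
        (4 : ℝ) ^ t * Real.exp (n * cfPressure A t) :=
      (mul_le_mul_of_nonneg_left h1 hB0.le).trans (h2.trans h3)
    have hlog := Real.log_le_log (by positivity) hchain
    rw [Real.log_mul hB0.ne' (Real.exp_pos _).ne', Real.log_exp, Real.log_mul (by positivity)
      (Real.exp_pos _).ne', Real.log_exp, Real.log_rpow (by positivity), Real.log_rpow (by norm_num),
      Real.log_pow, Real.log_pow] at hlog
    have e : (n : ℝ) * (cfPressure A s - 2 * (t - s) * Real.log ((B : ℝ) + 1) - cfPressure A t) =
        -(t - s) * ((2 : ℕ) * ((n : ℝ) * Real.log ((B : ℝ) + 1))) + n * cfPressure A s -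
          n * cfPressure A t := by push_cast; ring
    rw [e]
    linarith
  have := nonpos_of_nat_mul_le key
  linarith

/-- `P_A` is antitone on `[0, ∞)`. [cite: MageeOhWinter2019, §2.2] -/
theorem cfPressure_antitoneOn (hne : A.Nonempty) : AntitoneOn (cfPressure A) (Ici 0) := by
  intro s hs t _ hst
  have := cfPressure_le_sub hA hne hs hst
  nlinarith [Real.log_nonneg (by norm_num : (1 : ℝ) ≤ 2)]

/-- `P_A` is strictly antitone on `[0, ∞)`. [cite: MageeOhWinter2019, §2.2] -/
theorem cfPressure_strictAntiOn (hne : A.Nonempty) : StrictAntiOn (cfPressure A) (Ici 0) := by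
  intro s hs t _ hst
  have := cfPressure_le_sub hA hne hs hst.le
  nlinarith [Real.log_pos (by norm_num : (1 : ℝ) < 2)]

/-- `P_A` is Lipschitz (constant `2 log (B+1)`, `A ⊆ [1,B]`) on `[0, ∞)`. [folklore] -/
theorem abs_cfPressure_sub_le (hne : A.Nonempty) {B : ℕ} (hB : ∀ a ∈ A, a ≤ B) {s t : ℝ} (hs : 0 ≤ s) (ht : 0 ≤ t) :
    |cfPressure A t - cfPressure A s| ≤ 2 * Real.log ((B : ℝ) + 1) * |t - s| := by
  have hlog2 : 0 ≤ Real.log 2 := Real.log_nonneg (by norm_num)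
  wlog hst : s ≤ t generalizing s t
  · have h := this ht hs (le_of_not_ge hst)
    rwa [abs_sub_comm, abs_sub_comm s t] at h
  have h1 := cfPressure_le_sub hA hne hs hst
  have h2 := sub_le_cfPressure hA hne hB hs hst
  rw [abs_of_nonpos (by nlinarith), abs_of_nonneg (by linarith)]
  nlinarith

/-- `P_A` is continuous on `[0, ∞)`. [folklore] -/
theorem continuousOn_cfPressure (hne : A.Nonempty) : ContinuousOn (cfPressure A) (Ici 0) := by
  obtain ⟨B, hB⟩ : ∃ B, ∀ a ∈ A, a ≤ B := ⟨A.sup id, fun a ha => Finset.le_sup (f := id) ha⟩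
  have hL : LipschitzOnWith (Real.toNNReal (2 * Real.log ((B : ℝ) + 1))) (cfPressure A) (Ici 0) := by
    refine LipschitzOnWith.of_dist_le_mul fun s hs t ht => ?_
    rw [Real.dist_eq, Real.dist_eq, Real.coe_toNNReal _
      (mul_nonneg zero_le_two (Real.log_nonneg (by linarith [(Nat.cast_nonneg B : (0 : ℝ) ≤ B)])))]
    exact abs_cfPressure_sub_le hA hne hB ht hs
  exact hL.continuousOn

/-- `P_A(s) ≤ log #A - s log 2` for `s ≥ 0`; in particular `P_A(s) → -∞`. [folklore] -/
theorem cfPressure_le_log_card_sub (hne : A.Nonempty) {s : ℝ} (hs : 0 ≤ s) :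
    cfPressure A s ≤ Real.log A.card - s * Real.log 2 := by
  have := cfPressure_le_sub hA hne le_rfl hs
  rw [cfPressure_zero hA hne, sub_zero] at this
  exact this

end pressure

/-! ### The zero of the pressure -/

variable (A) in
/-- The **critical exponent** `s_A`: the zero of the pressure function (defined as
`inf {s ≥ 0 : P_A(s) ≤ 0}`; for `#A ≥ 2` it is the unique zero of `P_A` on `[0, ∞)` and is
positive). [cite: MageeOhWinter2019, §2.2] -/
def cfPressureZero : ℝ := sInf {s : ℝ | 0 ≤ s ∧ cfPressure A s ≤ 0}

/-- `#A ≥ 2 ⇒ A ≠ ∅`. [folklore] -/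
theorem nonempty_of_two_le_card (h2 : 2 ≤ A.card) : A.Nonempty := Finset.card_pos.1 (by omega)

section zero

variable (hA : ∀ a ∈ A, 1 ≤ a) (h2 : 2 ≤ A.card)
include hA h2

/-- `P_A(0) = log #A > 0` for `#A ≥ 2`. [folklore] -/
theorem cfPressure_zero_pos : 0 < cfPressure A 0 := by
  rw [cfPressure_zero hA (nonempty_of_two_le_card h2)]
  exact Real.log_pos (by exact_mod_cast h2)

/-- Existence of a zero of `P_A` in `(0, log #A / log 2 + 1]`. [folklore] -/
theorem exists_cfPressure_eq_zero :
    ∃ s : ℝ, 0 < s ∧ s ≤ Real.log A.card / Real.log 2 + 1 ∧ cfPressure A s = 0 := by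
  have hne := nonempty_of_two_le_card h2
  set S : ℝ := Real.log A.card / Real.log 2 + 1 with hS
  have hlog2 : 0 < Real.log 2 := Real.log_pos (by norm_num)
  have hlogA : 0 < Real.log A.card := Real.log_pos (by exact_mod_cast h2)
  have hS0 : 0 ≤ S := by positivity
  have hPS : cfPressure A S < 0 := by
    have h := cfPressure_le_log_card_sub hA hne hS0
    have : S * Real.log 2 = Real.log A.card + Real.log 2 := by
      rw [hS]; field_simp
    linarith
  have hP0 := cfPressure_zero_pos hA h2
  have hIVT := intermediate_value_Icc' hS0 ((continuousOn_cfPressure hA hne).mono Icc_subset_Ici_self)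
  obtain ⟨s, ⟨hs0, hsS⟩, hs⟩ := hIVT ⟨hPS.le, hP0.le⟩
  refine ⟨s, ?_, hsS, hs⟩
  rcases hs0.eq_or_lt with rfl | h
  · exact absurd hs hP0.ne'
  · exact h

/-- For `0 ≤ s`: `P_A(s) ≤ 0 ↔ s_* ≤ s`, where `s_*` is any zero of `P_A` in `[0, ∞)`. [folklore] -/
theorem cfPressure_nonpos_iff {z : ℝ} (hz0 : 0 ≤ z) (hz : cfPressure A z = 0) {s : ℝ} (hs : 0 ≤ s) :
    cfPressure A s ≤ 0 ↔ z ≤ s := by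
  have hne := nonempty_of_two_le_card h2
  constructor
  · intro h
    by_contra hlt
    push Not at hlt
    have := cfPressure_strictAntiOn hA hne hs hz0 hlt
    linarith
  · intro h
    have := cfPressure_antitoneOn hA hne hz0 hs h
    linarith

/-- **The pressure vanishes at the critical exponent:** `P_A(s_A) = 0`. [cite: MageeOhWinter2019, §2.2] -/
theorem cfPressure_cfPressureZero : cfPressure A (cfPressureZero A) = 0 := by
  obtain ⟨z, hz0, -, hz⟩ := exists_cfPressure_eq_zero hA h2
  have hset : {s : ℝ | 0 ≤ s ∧ cfPressure A s ≤ 0} = Ici z := by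
    ext s
    simp only [mem_setOf_eq, mem_Ici]
    constructor
    · rintro ⟨hs, hP⟩
      exact (cfPressure_nonpos_iff hA h2 hz0.le hz hs).1 hP
    · intro h
      exact ⟨hz0.le.trans h, (cfPressure_nonpos_iff hA h2 hz0.le hz (hz0.le.trans h)).2 h⟩
  rw [cfPressureZero, hset, csInf_Ici]
  exact hz

/-- `s_A > 0`. [cite: MageeOhWinter2019, §2.2] -/
theorem cfPressureZero_pos : 0 < cfPressureZero A := by
  have h := cfPressure_cfPressureZero hA h2
  have h0 := cfPressure_zero_pos hA h2
  rw [cfPressureZero] at h ⊢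
  by_contra hle
  push Not at hle
  have hge : 0 ≤ sInf {s : ℝ | 0 ≤ s ∧ cfPressure A s ≤ 0} :=
    Real.sInf_nonneg fun s hs => hs.1
  have heq : sInf {s : ℝ | 0 ≤ s ∧ cfPressure A s ≤ 0} = 0 := le_antisymm hle hge
  rw [heq] at h
  linarith

/-- `s_A ≤ log #A / log 2 + 1`. [folklore] -/
theorem cfPressureZero_le : cfPressureZero A ≤ Real.log A.card / Real.log 2 + 1 := by
  obtain ⟨z, hz0, hzS, hz⟩ := exists_cfPressure_eq_zero hA h2
  have h := cfPressure_cfPressureZero hA h2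
  have hδ0 := (cfPressureZero_pos hA h2).le
  have := (cfPressure_nonpos_iff hA h2 hδ0 h hz0.le).1 hz.le
  linarith

/-- **Uniqueness of the zero:** a zero of `P_A` in `[0, ∞)` is `s_A`. [cite: MageeOhWinter2019, §2.2] -/
theorem cfPressureZero_unique {z : ℝ} (hz0 : 0 ≤ z) (hz : cfPressure A z = 0) :
    z = cfPressureZero A := by
  have h := cfPressure_cfPressureZero hA h2
  have hδ0 := (cfPressureZero_pos hA h2).le
  have h1 := (cfPressure_nonpos_iff hA h2 hz0 hz hδ0).1 h.le
  have h2' := (cfPressure_nonpos_iff hA h2 hδ0 h hz0).1 hz.le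
  linarith

/-- `P_A(s) > 0` for `0 ≤ s < s_A`. [folklore] -/
theorem cfPressure_pos_of_lt {s : ℝ} (hs : 0 ≤ s) (hlt : s < cfPressureZero A) :
    0 < cfPressure A s := by
  have h := cfPressure_cfPressureZero hA h2
  by_contra hle
  push Not at hle
  have := (cfPressure_nonpos_iff hA h2 (cfPressureZero_pos hA h2).le h hs).1 hle
  linarith

/-- `P_A(s) < 0` for `s > s_A`. [folklore] -/
theorem cfPressure_neg_of_lt {s : ℝ} (hlt : cfPressureZero A < s) : cfPressure A s < 0 := by
  have hne := nonempty_of_two_le_card h2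
  have h := cfPressure_cfPressureZero hA h2
  have hδ0 := (cfPressureZero_pos hA h2).le
  have := cfPressure_strictAntiOn hA hne hδ0 (hδ0.trans hlt.le) hlt
  linarith

/-- `P_A(s) ≥ 0` for `0 ≤ s ≤ s_A`. [folklore] -/
theorem cfPressure_nonneg_of_le {s : ℝ} (hs : 0 ≤ s) (hle : s ≤ cfPressureZero A) :
    0 ≤ cfPressure A s := by
  have hne := nonempty_of_two_le_card h2
  have h := cfPressure_cfPressureZero hA h2
  have := cfPressure_antitoneOn hA hne hs ((cfPressureZero_pos hA h2).le) hle
  linarith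

/-- **Gibbs property at the critical exponent, lower:** `1 ≤ Z_n(s)` for all `n` and
`0 ≤ s ≤ s_A`. [folklore] -/
theorem one_le_cfPartition_of_le {s : ℝ} (hs : 0 ≤ s) (hle : s ≤ cfPressureZero A) (n : ℕ) :
    1 ≤ cfPartition A n s := by
  have hne := nonempty_of_two_le_card h2
  have hP := cfPressure_nonneg_of_le hA h2 hs hle
  calc (1 : ℝ) ≤ Real.exp (n * cfPressure A s) := Real.one_le_exp (by positivity)
    _ ≤ cfPartition A n s := exp_mul_cfPressure_le hA hne hs n

/-- `1 ≤ Z_n(s_A)` for all `n`. [folklore] -/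
theorem one_le_cfPartition_cfPressureZero (n : ℕ) : 1 ≤ cfPartition A n (cfPressureZero A) :=
  one_le_cfPartition_of_le hA h2 (cfPressureZero_pos hA h2).le le_rfl n

/-- **Gibbs property at the critical exponent, upper:** `Z_n(s_A) ≤ 4^{s_A}` for all `n`.
[folklore] -/
theorem cfPartition_cfPressureZero_le (n : ℕ) :
    cfPartition A n (cfPressureZero A) ≤ (4 : ℝ) ^ cfPressureZero A := by
  have hne := nonempty_of_two_le_card h2
  have h := cfPartition_le_exp hA hne (cfPressureZero_pos hA h2).le n
  rw [cfPressure_cfPressureZero hA h2, mul_zero, Real.exp_zero, mul_one] at h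
  exact h

/-- For `s > s_A` the partition functions decay exponentially: `Z_n(s) ≤ 4^s e^{n P_A(s)}` with
`P_A(s) < 0`, so `Z_n(s) → 0`. [folklore] -/
theorem tendsto_cfPartition_zero_of_lt {s : ℝ} (hlt : cfPressureZero A < s) :
    Tendsto (fun n : ℕ => cfPartition A n s) atTop (𝓝 0) := by
  have hne := nonempty_of_two_le_card h2
  have hs : 0 ≤ s := (cfPressureZero_pos hA h2).le.trans hlt.le
  have hP := cfPressure_neg_of_lt hA h2 hlt
  have hexp : Tendsto (fun n : ℕ => (4 : ℝ) ^ s * Real.exp (n * cfPressure A s)) atTop (𝓝 0) := by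
    have h1 : Tendsto (fun n : ℕ => (n : ℝ) * cfPressure A s) atTop atBot :=
      tendsto_natCast_atTop_atTop.atTop_mul_const_of_neg hP
    have h2 := Real.tendsto_exp_atBot.comp h1
    simpa using h2.const_mul ((4 : ℝ) ^ s)
  refine squeeze_zero (fun n => (cfPartition_pos hA hne n s).le) (fun n => ?_) hexp
  exact cfPartition_le_exp hA hne hs n

end zero

end Literature.NumberTheory.Sieve
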